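import Summits.QuantumFields.QCD.Theorems.SpectralDefectExtinctionTipPricingStubColdBoxIntegrable
import Summits.QuantumFields.QCD.Theorems.SpectralDefectExtinctionTipPricingStubColdBoxKatoFloor
import Literature.MathematicalPhysics.QuantumFieldTheory.QCDPhaseQuenchedTranslation

/-!
# Helper `stub_coldBoxTranslation` for stub `stub_coldBoxTail` of line `covariant-laplacian-floor`
(crux `Summit.QuantumFields.QCD.Theses.SpectralDefectExtinction.TipPricing`, item stmt-QuantumFields-8967)

**The phase-quenched expected cold-box COUNT is the volume times the probability of ONE cold box.**
For all `Nf S R E' β b`: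

  `∫ #{c ∈ {−S,…,S}⁴ : torusBox (2S+1) c R is E'-cold for U} · ∏_f |det D_W(U,b_f,1)| dμ_β(U)
     = (2S+1)⁴ · ∫ 1[torusBox (2S+1) 0 R is E'-cold for U] · ∏_f |det D_W(U,b_f,1)| dμ_β(U)`,

`μ_β = wilsonMeasure (fundamentalRep (Fin 3)) β` on `SU(3)` link fields of `(ℤ/(2S+1))⁴`; a set of sites `B`
is `E'`-cold for `U` iff some non-zero colour field `v` supported in `B` has `Re⟨v, Lap_U v⟩ ≤ E' Σ|v i|²`,
`Lap_U = Σ_μ (2 − F_μ − F_μᴴ)`, `F_μ = linkHop`.  So the second conjunct of `stub_coldBoxTail` is EXACTLY the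
single-event large deviation `P₊(torusBox (2S+1) 0 R is E'-cold) ≤ e^{−Aβ}` under the phase-quenched measure.

**Proof.**  Torus translations `τ_v U (x, μ) = U(x − v, μ)` (tree `torusConfigShift`) reindex the twisted
shifts and hence the covariant Laplacian by `(x, a) ↦ (x − v, a)` (`shift_linkHop_apply`, `shift_lap_apply`),
so `B` is cold for `τ_v U` iff `B' = {x | x + v ∈ B}` is cold for `U` (`shift_cold_imp`, applied twice through
the involution `τ_{−v} ∘ τ_v = id`); with `v = −proj c`, `torusBox 0 R` for `τ_v U` is `torusBox c R` for `U`
(`shift_mem_torusBox_iff`).  The Wilson measure is translation invariant (`wilsonMeasure_map_torusConfigShift`)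
and so is the weight (`det_diracMatrix_torusConfigShift`, `norm_det_diracMatrix`), whence every centre
contributes the integral of the centre `0` (`shift_integral_indicator_eq`); the count is the sum over the
`(2S+1)⁴` centres of `box 4 S` of the indicators (each integrable: closed event times continuous weight,
`coldInt_isClosed_cold`, `integrable_mul_weight`).  Mathlib and tree facts only; no named unproved facts.

**What remains of `stub_coldBoxTail`** (`coldBoxTail_of_singleBoxLD`, sorry-free glue): with the landed
`stub_coldBoxIntegrable` (first conjunct), `coldBox_filter_eq_empty` (Kato floor: no cold proper box when
`(2R+1)² E' < 4`, in particular when `E' ≤ 1/β` and `(2R+1)² < 4β`) and the present identity, the registered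
statement of `stub_coldBoxTail` follows from the SINGLE-EVENT weak-coupling large deviation

  `∀ Nf A > 0, ∃ β₀, ∀ β ≥ β₀, ∀ S R, R+1 ≤ S → R ≤ β → 4β ≤ (2R+1)² → ∀ E' ≤ 1/β, ∀ |b_f| ≤ 1:
     P₊(torusBox (2S+1) 0 R is E'-cold) := ∫ 1[cold] ∏_f|det D_W(U,b_f,1)| dμ_β / ∫ ∏_f|det D_W(U,b_f,1)| dμ_β ≤ e^{−Aβ}`,

which is NOT in the tree (chessboard / reflection-positivity free-energy bounds or Bałaban small-field control of
the 4D `SU(3)` Wilson measure at weak coupling, plus a local quenched → phase-quenched comparison).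
-/

namespace Summit.QuantumFields.QCD.Cruxes.TipPricing.CovariantLaplacianFloor

open MeasureTheory Filter Matrix
open Literature.MathematicalPhysics.QuantumLattice Literature.MathematicalPhysics.QuantumFieldTheory
  Literature.Probability.LatticeModels
open Summit.QuantumFields.QCD.Theses.SpectralDefectExtinction
open scoped Classical

noncomputable section

section Shift

variable {L : ℕ} [NeZero L]

omit [NeZero L] in
/-- The twisted shift of a translated field is the twisted shift reindexed by `(x, a) ↦ (x − v, a)`. -/
theorem shift_linkHop_apply (v : TorusSite 4 L) (U : GaugeConfig 4 L SU3) (μ : Fin 4)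
    (p q : TorusSite 4 L × Fin 3) :
    linkHop (fundamentalRep (Fin 3)) (torusConfigShift v U) μ p q =
      linkHop (fundamentalRep (Fin 3)) U μ (p.1 - v, p.2) (q.1 - v, q.2) := by
  have hs : ∀ (x : TorusSite 4 L) (ν : Fin 4),
      Literature.MathematicalPhysics.QuantumFieldTheory.Site.shift (x - v) ν =
        Literature.MathematicalPhysics.QuantumFieldTheory.Site.shift x ν - v :=
    fun x ν => by simp only [Literature.MathematicalPhysics.QuantumFieldTheory.Site.shift, add_sub_right_comm]
  simp only [linkHop, Matrix.of_apply, torusConfigShift_apply, hs, sub_left_inj]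

omit [NeZero L] in
/-- The covariant Laplacian of a translated field is the Laplacian reindexed by `(x, a) ↦ (x − v, a)`. -/
theorem shift_lap_apply (v : TorusSite 4 L) (U : GaugeConfig 4 L SU3) (p q : TorusSite 4 L × Fin 3) :
    (∑ μ : Fin 4, ((2 : ℂ) • (1 : Matrix (TorusSite 4 L × Fin 3) (TorusSite 4 L × Fin 3) ℂ)
      - linkHop (fundamentalRep (Fin 3)) (torusConfigShift v U) μ
      - (linkHop (fundamentalRep (Fin 3)) (torusConfigShift v U) μ)ᴴ)) p q =
    (∑ μ : Fin 4, ((2 : ℂ) • (1 : Matrix (TorusSite 4 L × Fin 3) (TorusSite 4 L × Fin 3) ℂ)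
      - linkHop (fundamentalRep (Fin 3)) U μ
      - (linkHop (fundamentalRep (Fin 3)) U μ)ᴴ)) (p.1 - v, p.2) (q.1 - v, q.2) := by
  have hpq : ((p.1 - v, p.2) = (q.1 - v, q.2)) ↔ p = q := by
    rw [Prod.mk.injEq, sub_left_inj, ← Prod.ext_iff]
  simp only [Matrix.sum_apply, Matrix.sub_apply, Matrix.smul_apply, Matrix.conjTranspose_apply,
    Matrix.one_apply, shift_linkHop_apply, hpq]

/-- The Dirichlet form of the reindexed Laplacian is the form of the Laplacian on the translated vector
`u'(x, a) = u(x + v, a)`. -/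
theorem shift_form_eq (v : TorusSite 4 L) (U : GaugeConfig 4 L SU3) (u : TorusSite 4 L × Fin 3 → ℂ) :
    star u ⬝ᵥ (∑ μ : Fin 4, ((2 : ℂ) • (1 : Matrix (TorusSite 4 L × Fin 3) (TorusSite 4 L × Fin 3) ℂ)
      - linkHop (fundamentalRep (Fin 3)) (torusConfigShift v U) μ
      - (linkHop (fundamentalRep (Fin 3)) (torusConfigShift v U) μ)ᴴ)) *ᵥ u =
    star (fun q : TorusSite 4 L × Fin 3 => u (q.1 + v, q.2)) ⬝ᵥ
      (∑ μ : Fin 4, ((2 : ℂ) • (1 : Matrix (TorusSite 4 L × Fin 3) (TorusSite 4 L × Fin 3) ℂ)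
        - linkHop (fundamentalRep (Fin 3)) U μ
        - (linkHop (fundamentalRep (Fin 3)) U μ)ᴴ)) *ᵥ fun q : TorusSite 4 L × Fin 3 => u (q.1 + v, q.2) := by
  set A : Matrix (TorusSite 4 L × Fin 3) (TorusSite 4 L × Fin 3) ℂ :=
    ∑ μ : Fin 4, ((2 : ℂ) • (1 : Matrix (TorusSite 4 L × Fin 3) (TorusSite 4 L × Fin 3) ℂ)
      - linkHop (fundamentalRep (Fin 3)) U μ - (linkHop (fundamentalRep (Fin 3)) U μ)ᴴ) with hA
  have hentry : ∀ p q : TorusSite 4 L × Fin 3,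
      (∑ μ : Fin 4, ((2 : ℂ) • (1 : Matrix (TorusSite 4 L × Fin 3) (TorusSite 4 L × Fin 3) ℂ)
        - linkHop (fundamentalRep (Fin 3)) (torusConfigShift v U) μ
        - (linkHop (fundamentalRep (Fin 3)) (torusConfigShift v U) μ)ᴴ)) p q = A (p.1 - v, p.2) (q.1 - v, q.2) :=
    fun p q => shift_lap_apply v U p q
  simp only [dotProduct, mulVec, Pi.star_apply, hentry]
  have hinner : ∀ p' : TorusSite 4 L × Fin 3,
      ∑ q, A p' (q.1 - v, q.2) * u q = ∑ q, A p' q * u (q.1 + v, q.2) := fun p' =>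
    Fintype.sum_equiv (Equiv.prodCongr (Equiv.subRight v) (Equiv.refl (Fin 3))) _ _ fun q => by
      obtain ⟨x, a⟩ := q
      simp
  simp only [hinner]
  exact Fintype.sum_equiv (Equiv.prodCongr (Equiv.subRight v) (Equiv.refl (Fin 3))) _ _ fun p => by
    obtain ⟨x, a⟩ := p
    simp

/-- The mass of the translated vector. -/
theorem shift_mass_eq (v : TorusSite 4 L) (u : TorusSite 4 L × Fin 3 → ℂ) :
    ∑ i, ‖(fun q : TorusSite 4 L × Fin 3 => u (q.1 + v, q.2)) i‖ ^ 2 = ∑ i, ‖u i‖ ^ 2 :=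
  Fintype.sum_equiv (Equiv.prodCongr (Equiv.addRight v) (Equiv.refl (Fin 3))) _ _ fun _ => rfl

omit [NeZero L] in
/-- Translations compose: `τ_{−v} (τ_v U) = U`. -/
theorem shift_neg_shift (v : TorusSite 4 L) (U : GaugeConfig 4 L SU3) :
    torusConfigShift (-v) (torusConfigShift v U) = U := by
  funext e
  simp only [torusConfigShift_apply, sub_neg_eq_add, add_sub_cancel_right, Prod.mk.eta]

/-- **Cold sets move with the field.**  If `B` is `E'`-cold for the translated field `τ_v U`, then
`B' = {x | x + v ∈ B}` is `E'`-cold for `U`. -/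
theorem shift_cold_imp (v : TorusSite 4 L) (U : GaugeConfig 4 L SU3) (E' : ℝ)
    (B B' : Finset (TorusSite 4 L)) (hBB' : ∀ x, x ∈ B' ↔ x + v ∈ B) :
    (∃ u : TorusSite 4 L × Fin 3 → ℂ, u ≠ 0 ∧
      (∀ p : TorusSite 4 L × Fin 3, p.1 ∉ B → u p = 0) ∧
      (star u ⬝ᵥ (∑ μ : Fin 4, ((2 : ℂ) • (1 : Matrix (TorusSite 4 L × Fin 3) (TorusSite 4 L × Fin 3) ℂ)
        - linkHop (fundamentalRep (Fin 3)) (torusConfigShift v U) μ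
        - (linkHop (fundamentalRep (Fin 3)) (torusConfigShift v U) μ)ᴴ)) *ᵥ u).re
        ≤ E' * ∑ i, ‖u i‖ ^ 2) →
    (∃ u : TorusSite 4 L × Fin 3 → ℂ, u ≠ 0 ∧
      (∀ p : TorusSite 4 L × Fin 3, p.1 ∉ B' → u p = 0) ∧
      (star u ⬝ᵥ (∑ μ : Fin 4, ((2 : ℂ) • (1 : Matrix (TorusSite 4 L × Fin 3) (TorusSite 4 L × Fin 3) ℂ)
        - linkHop (fundamentalRep (Fin 3)) U μ
        - (linkHop (fundamentalRep (Fin 3)) U μ)ᴴ)) *ᵥ u).re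
        ≤ E' * ∑ i, ‖u i‖ ^ 2) := by
  rintro ⟨u, hu0, hsupp, hle⟩
  refine ⟨fun q => u (q.1 + v, q.2), fun h0 => hu0 ?_, fun p hp => ?_, ?_⟩
  · funext p
    have := congrFun h0 (p.1 - v, p.2)
    simpa only [sub_add_cancel, Prod.mk.eta, Pi.zero_apply] using this
  · exact hsupp (p.1 + v, p.2) fun h => hp ((hBB' p.1).mpr h)
  · rw [← shift_form_eq, shift_mass_eq]
    exact hle

omit [NeZero L] in
/-- The box about `c` is the box about `0` translated by `proj c`. -/
theorem shift_mem_torusBox_iff (c : Site 4) (R : ℕ) (x : TorusSite 4 L) :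
    x ∈ torusBox L c R ↔ x + -Torus.proj L c ∈ torusBox L 0 R := by
  have hadd : ∀ y : Site 4, Torus.proj L (c + y) = Torus.proj L c + Torus.proj L y := fun y => by
    funext i; simp [Torus.proj_apply]
  simp only [torusBox, Finset.mem_image, zero_add]
  constructor
  · rintro ⟨y, hy, rfl⟩
    exact ⟨y, hy, by rw [hadd]; abel⟩
  · rintro ⟨y, hy, hyx⟩
    exact ⟨y, hy, by rw [hadd, hyx]; abel⟩

/-- The phase-quenched weight is translation invariant. -/
theorem shift_weight_eq {Nf : ℕ} (b : Fin Nf → ℝ) (v : TorusSite 4 L) (U : GaugeConfig 4 L SU3) :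
    ∏ f : Fin Nf, ‖fermionDet (wilsonDirac (fundamentalRep (Fin 3)) (torusConfigShift v U) (b f) 1)‖ =
      ∏ f : Fin Nf, ‖fermionDet (wilsonDirac (fundamentalRep (Fin 3)) U (b f) 1)‖ := by
  rw [← norm_det_diracMatrix, ← norm_det_diracMatrix, det_diracMatrix_torusConfigShift]

/-- **Every centre contributes the same**: the weighted probability that the box about `c` is cold equals
the weighted probability that the box about `0` is cold (translation invariance of the Wilson measure and
of the weight, covariance of the cold event). -/
theorem shift_integral_indicator_eq {Nf : ℕ} (b : Fin Nf → ℝ) (β E' : ℝ) (R : ℕ) (c : Site 4) :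
    ∫ U, (if (∃ u : TorusSite 4 L × Fin 3 → ℂ, u ≠ 0 ∧
          (∀ p : TorusSite 4 L × Fin 3, p.1 ∉ torusBox L c R → u p = 0) ∧
          (star u ⬝ᵥ (∑ μ : Fin 4, ((2 : ℂ) • (1 : Matrix (TorusSite 4 L × Fin 3) (TorusSite 4 L × Fin 3) ℂ)
            - linkHop (fundamentalRep (Fin 3)) U μ
            - (linkHop (fundamentalRep (Fin 3)) U μ)ᴴ)) *ᵥ u).re
            ≤ E' * ∑ i, ‖u i‖ ^ 2) then (1 : ℝ) else 0) *
        ∏ f : Fin Nf, ‖fermionDet (wilsonDirac (fundamentalRep (Fin 3)) U (b f) 1)‖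
      ∂(wilsonMeasure (d := 4) (L := L) (fundamentalRep (Fin 3)) β) =
    ∫ U, (if (∃ u : TorusSite 4 L × Fin 3 → ℂ, u ≠ 0 ∧
          (∀ p : TorusSite 4 L × Fin 3, p.1 ∉ torusBox L 0 R → u p = 0) ∧
          (star u ⬝ᵥ (∑ μ : Fin 4, ((2 : ℂ) • (1 : Matrix (TorusSite 4 L × Fin 3) (TorusSite 4 L × Fin 3) ℂ)
            - linkHop (fundamentalRep (Fin 3)) U μ
            - (linkHop (fundamentalRep (Fin 3)) U μ)ᴴ)) *ᵥ u).re
            ≤ E' * ∑ i, ‖u i‖ ^ 2) then (1 : ℝ) else 0) *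
        ∏ f : Fin Nf, ‖fermionDet (wilsonDirac (fundamentalRep (Fin 3)) U (b f) 1)‖
      ∂(wilsonMeasure (d := 4) (L := L) (fundamentalRep (Fin 3)) β) := by
  set v : TorusSite 4 L := -Torus.proj L c with hv
  -- the integrand about `c` is the integrand about `0` evaluated at the translated field
  set G : GaugeConfig 4 L SU3 → ℝ := fun U => (if (∃ u : TorusSite 4 L × Fin 3 → ℂ, u ≠ 0 ∧
          (∀ p : TorusSite 4 L × Fin 3, p.1 ∉ torusBox L 0 R → u p = 0) ∧
          (star u ⬝ᵥ (∑ μ : Fin 4, ((2 : ℂ) • (1 : Matrix (TorusSite 4 L × Fin 3) (TorusSite 4 L × Fin 3) ℂ)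
            - linkHop (fundamentalRep (Fin 3)) U μ
            - (linkHop (fundamentalRep (Fin 3)) U μ)ᴴ)) *ᵥ u).re
            ≤ E' * ∑ i, ‖u i‖ ^ 2) then (1 : ℝ) else 0) *
        ∏ f : Fin Nf, ‖fermionDet (wilsonDirac (fundamentalRep (Fin 3)) U (b f) 1)‖ with hG
  have hcold : ∀ U : GaugeConfig 4 L SU3,
      (∃ u : TorusSite 4 L × Fin 3 → ℂ, u ≠ 0 ∧
          (∀ p : TorusSite 4 L × Fin 3, p.1 ∉ torusBox L c R → u p = 0) ∧
          (star u ⬝ᵥ (∑ μ : Fin 4, ((2 : ℂ) • (1 : Matrix (TorusSite 4 L × Fin 3) (TorusSite 4 L × Fin 3) ℂ)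
            - linkHop (fundamentalRep (Fin 3)) U μ
            - (linkHop (fundamentalRep (Fin 3)) U μ)ᴴ)) *ᵥ u).re
            ≤ E' * ∑ i, ‖u i‖ ^ 2) ↔
      (∃ u : TorusSite 4 L × Fin 3 → ℂ, u ≠ 0 ∧
          (∀ p : TorusSite 4 L × Fin 3, p.1 ∉ torusBox L 0 R → u p = 0) ∧
          (star u ⬝ᵥ (∑ μ : Fin 4, ((2 : ℂ) • (1 : Matrix (TorusSite 4 L × Fin 3) (TorusSite 4 L × Fin 3) ℂ)
            - linkHop (fundamentalRep (Fin 3)) (torusConfigShift v U) μ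
            - (linkHop (fundamentalRep (Fin 3)) (torusConfigShift v U) μ)ᴴ)) *ᵥ u).re
            ≤ E' * ∑ i, ‖u i‖ ^ 2) := by
    intro U
    constructor
    · intro h
      rw [← shift_neg_shift v U] at h
      refine shift_cold_imp (-v) (torusConfigShift v U) E' (torusBox L c R) (torusBox L 0 R)
        (fun x => ?_) h
      rw [shift_mem_torusBox_iff c R (x + -v), hv, neg_neg, add_neg_cancel_right]
    · intro h
      refine shift_cold_imp v U E' (torusBox L 0 R) (torusBox L c R) (fun x => ?_) h
      rw [hv]
      exact shift_mem_torusBox_iff c R x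
  have hpt : ∀ U : GaugeConfig 4 L SU3,
      (if (∃ u : TorusSite 4 L × Fin 3 → ℂ, u ≠ 0 ∧
          (∀ p : TorusSite 4 L × Fin 3, p.1 ∉ torusBox L c R → u p = 0) ∧
          (star u ⬝ᵥ (∑ μ : Fin 4, ((2 : ℂ) • (1 : Matrix (TorusSite 4 L × Fin 3) (TorusSite 4 L × Fin 3) ℂ)
            - linkHop (fundamentalRep (Fin 3)) U μ
            - (linkHop (fundamentalRep (Fin 3)) U μ)ᴴ)) *ᵥ u).re
            ≤ E' * ∑ i, ‖u i‖ ^ 2) then (1 : ℝ) else 0) *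
        ∏ f : Fin Nf, ‖fermionDet (wilsonDirac (fundamentalRep (Fin 3)) U (b f) 1)‖ =
      G (torusConfigShift v U) := by
    intro U
    simp only [hG, shift_weight_eq b v U, hcold U]
  calc _ = ∫ U, G (torusConfigShift v U) ∂(wilsonMeasure (d := 4) (L := L) (fundamentalRep (Fin 3)) β) :=
        integral_congr_ae (Eventually.of_forall hpt)
    _ = ∫ U, G U ∂((wilsonMeasure (d := 4) (L := L) (fundamentalRep (Fin 3)) β).map (torusConfigShift v)) :=
        (integral_map_equiv _ G).symm
    _ = ∫ U, G U ∂(wilsonMeasure (d := 4) (L := L) (fundamentalRep (Fin 3)) β) := by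
        rw [wilsonMeasure_map_torusConfigShift]

end Shift

/-! ## The expected count is the volume times the one-box probability -/

/-- **Expected cold-box count = volume × one-box probability** (helper for stub `stub_coldBoxTail` of line
`covariant-laplacian-floor`).  For all `Nf S R E' β b`: the `∏_f |det D_W(U,b_f,1)|`-weighted Wilson integral
of the number of `E'`-cold boxes of radius `R` centred in `{−S,…,S}⁴` equals `(2S+1)⁴` times the weighted
integral of the indicator that the box of radius `R` about the origin is `E'`-cold (translation invariance
of the Wilson measure and of the fermion weight; covariance of the cold event).  Dividing by the common
normalisation `∫ ∏_f |det D_W| dμ_β`, the ratio of `stub_coldBoxTail` is `(2S+1)⁴ · P₊(torusBox (2S+1) 0 R cold)`. -/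
theorem stub_coldBoxTranslation :
    ∀ (Nf S R : ℕ) (E' β : ℝ) (b : Fin Nf → ℝ),
      ∫ U, (((box 4 S).filter fun c : Site 4 =>
            ∃ v : TorusSite 4 (2 * S + 1) × Fin 3 → ℂ, v ≠ 0 ∧
              (∀ p : TorusSite 4 (2 * S + 1) × Fin 3, p.1 ∉ torusBox (2 * S + 1) c R → v p = 0) ∧
              (star v ⬝ᵥ (∑ μ : Fin 4, ((2 : ℂ) • (1 : Matrix (TorusSite 4 (2 * S + 1) × Fin 3)
                  (TorusSite 4 (2 * S + 1) × Fin 3) ℂ)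
                - linkHop (fundamentalRep (Fin 3)) U μ
                - (linkHop (fundamentalRep (Fin 3)) U μ)ᴴ)) *ᵥ v).re
                ≤ E' * ∑ i, ‖v i‖ ^ 2).card : ℝ) *
            ∏ f : Fin Nf, ‖fermionDet (wilsonDirac (fundamentalRep (Fin 3)) U (b f) 1)‖
          ∂(wilsonMeasure (d := 4) (L := 2 * S + 1) (fundamentalRep (Fin 3)) β) =
      (2 * S + 1 : ℝ) ^ 4 *
        ∫ U, (if (∃ v : TorusSite 4 (2 * S + 1) × Fin 3 → ℂ, v ≠ 0 ∧
              (∀ p : TorusSite 4 (2 * S + 1) × Fin 3, p.1 ∉ torusBox (2 * S + 1) 0 R → v p = 0) ∧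
              (star v ⬝ᵥ (∑ μ : Fin 4, ((2 : ℂ) • (1 : Matrix (TorusSite 4 (2 * S + 1) × Fin 3)
                  (TorusSite 4 (2 * S + 1) × Fin 3) ℂ)
                - linkHop (fundamentalRep (Fin 3)) U μ
                - (linkHop (fundamentalRep (Fin 3)) U μ)ᴴ)) *ᵥ v).re
                ≤ E' * ∑ i, ‖v i‖ ^ 2) then (1 : ℝ) else 0) *
            ∏ f : Fin Nf, ‖fermionDet (wilsonDirac (fundamentalRep (Fin 3)) U (b f) 1)‖
          ∂(wilsonMeasure (d := 4) (L := 2 * S + 1) (fundamentalRep (Fin 3)) β) := by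
  intro Nf S R E' β b
  -- the indicator of one centre, and its integrability
  set ind : Site 4 → GaugeConfig 4 (2 * S + 1) SU3 → ℝ := fun c U =>
    if (∃ v : TorusSite 4 (2 * S + 1) × Fin 3 → ℂ, v ≠ 0 ∧
        (∀ p : TorusSite 4 (2 * S + 1) × Fin 3, p.1 ∉ torusBox (2 * S + 1) c R → v p = 0) ∧
        (star v ⬝ᵥ (∑ μ : Fin 4, ((2 : ℂ) • (1 : Matrix (TorusSite 4 (2 * S + 1) × Fin 3)
            (TorusSite 4 (2 * S + 1) × Fin 3) ℂ)
          - linkHop (fundamentalRep (Fin 3)) U μ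
          - (linkHop (fundamentalRep (Fin 3)) U μ)ᴴ)) *ᵥ v).re
          ≤ E' * ∑ i, ‖v i‖ ^ 2) then (1 : ℝ) else 0 with hind
  have hmeas : ∀ c, Measurable (ind c) := fun c =>
    Measurable.ite (coldInt_isClosed_cold (torusBox (2 * S + 1) c R) E').measurableSet
      measurable_const measurable_const
  have hbound : ∀ c U, |ind c U| ≤ 1 := fun c U => by
    simp only [hind]
    split_ifs <;> simp
  have hint : ∀ c ∈ box 4 S, Integrable (fun U => ind c U *
      ∏ f : Fin Nf, ‖fermionDet (wilsonDirac (fundamentalRep (Fin 3)) U (b f) 1)‖)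
      (wilsonMeasure (d := 4) (L := 2 * S + 1) (fundamentalRep (Fin 3)) β) := fun c _ =>
    Theorems.ExtinctionBuildsQCD.Negative.integrable_mul_weight b β (hmeas c) (hbound c)
  -- the count as a sum of indicators
  have hcard : ∀ U : GaugeConfig 4 (2 * S + 1) SU3,
      (((box 4 S).filter fun c : Site 4 =>
            ∃ v : TorusSite 4 (2 * S + 1) × Fin 3 → ℂ, v ≠ 0 ∧
              (∀ p : TorusSite 4 (2 * S + 1) × Fin 3, p.1 ∉ torusBox (2 * S + 1) c R → v p = 0) ∧
              (star v ⬝ᵥ (∑ μ : Fin 4, ((2 : ℂ) • (1 : Matrix (TorusSite 4 (2 * S + 1) × Fin 3)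
                  (TorusSite 4 (2 * S + 1) × Fin 3) ℂ)
                - linkHop (fundamentalRep (Fin 3)) U μ
                - (linkHop (fundamentalRep (Fin 3)) U μ)ᴴ)) *ᵥ v).re
                ≤ E' * ∑ i, ‖v i‖ ^ 2).card : ℝ) *
            ∏ f : Fin Nf, ‖fermionDet (wilsonDirac (fundamentalRep (Fin 3)) U (b f) 1)‖ =
      ∑ c ∈ box 4 S, ind c U * ∏ f : Fin Nf, ‖fermionDet (wilsonDirac (fundamentalRep (Fin 3)) U (b f) 1)‖ := by
    intro U
    rw [← Finset.sum_mul, Finset.card_filter, Nat.cast_sum]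
    congr 1
    refine Finset.sum_congr rfl fun c _ => ?_
    simp only [hind]
    split_ifs <;> simp
  rw [integral_congr_ae (Eventually.of_forall hcard), integral_finsetSum _ hint,
    Finset.sum_congr rfl fun c _ => shift_integral_indicator_eq b β E' R c, Finset.sum_const, card_box,
    nsmul_eq_mul]
  push_cast
  rfl

/-! ## What remains: the single-box large deviation -/

/-- **Reduction of `stub_coldBoxTail` to ONE cold box** (sorry-free glue).  If, under the phase-quenched
measure at coupling `β ≥ β₀(Nf, A)`, the probability that the box of radius `R` about the origin is `E'`-cold
is `≤ e^{−Aβ}` whenever `R + 1 ≤ S`, `R ≤ β`, `4β ≤ (2R+1)²`, `E' ≤ 1/β`, `|b_f| ≤ 1` (hypothesis `hLD`, the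
missing weak-coupling large deviation), then the registered statement of `stub_coldBoxTail` holds:
integrability is `stub_coldBoxIntegrable`; for `(2R+1)² < 4β` no box is cold (`coldBox_filter_eq_empty`);
otherwise the expected count is `(2S+1)⁴ ×` the one-box probability (`stub_coldBoxTranslation`). -/
theorem coldBoxTail_of_singleBoxLD
    (hLD : ∀ (Nf : ℕ) (A : ℝ), 0 < A → ∃ β₀ : ℝ, ∀ β : ℝ, β₀ ≤ β →
      ∀ (S R : ℕ), R + 1 ≤ S → (R : ℝ) ≤ β → 4 * β ≤ (2 * R + 1 : ℝ) ^ 2 → ∀ E' : ℝ, E' ≤ 1 / β →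
      ∀ b : Fin Nf → ℝ, (∀ f, |b f| ≤ 1) →
        (∫ U, (if (∃ v : TorusSite 4 (2 * S + 1) × Fin 3 → ℂ, v ≠ 0 ∧
              (∀ p : TorusSite 4 (2 * S + 1) × Fin 3, p.1 ∉ torusBox (2 * S + 1) 0 R → v p = 0) ∧
              (star v ⬝ᵥ (∑ μ : Fin 4, ((2 : ℂ) • (1 : Matrix (TorusSite 4 (2 * S + 1) × Fin 3)
                  (TorusSite 4 (2 * S + 1) × Fin 3) ℂ)
                - linkHop (fundamentalRep (Fin 3)) U μ
                - (linkHop (fundamentalRep (Fin 3)) U μ)ᴴ)) *ᵥ v).re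
                ≤ E' * ∑ i, ‖v i‖ ^ 2) then (1 : ℝ) else 0) *
            ∏ f : Fin Nf, ‖fermionDet (wilsonDirac (fundamentalRep (Fin 3)) U (b f) 1)‖
          ∂(wilsonMeasure (d := 4) (L := 2 * S + 1) (fundamentalRep (Fin 3)) β)) /
          (∫ U, ∏ f : Fin Nf, ‖fermionDet (wilsonDirac (fundamentalRep (Fin 3)) U (b f) 1)‖
            ∂(wilsonMeasure (d := 4) (L := 2 * S + 1) (fundamentalRep (Fin 3)) β))
          ≤ Real.exp (-(A * β))) :
    ∀ (Nf : ℕ) (A : ℝ), 0 < A → ∃ β₀ : ℝ, ∀ β : ℝ, β₀ ≤ β →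
      ∀ (S R : ℕ), R + 1 ≤ S → (R : ℝ) ≤ β → ∀ E' : ℝ, E' ≤ 1 / β →
      ∀ b : Fin Nf → ℝ, (∀ f, |b f| ≤ 1) →
        Integrable (fun U : GaugeConfig 4 (2 * S + 1) SU3 =>
            (((box 4 S).filter fun c : Site 4 =>
              ∃ v : TorusSite 4 (2 * S + 1) × Fin 3 → ℂ, v ≠ 0 ∧
                (∀ p : TorusSite 4 (2 * S + 1) × Fin 3, p.1 ∉ torusBox (2 * S + 1) c R → v p = 0) ∧
                (star v ⬝ᵥ (∑ μ : Fin 4, ((2 : ℂ) • (1 : Matrix (TorusSite 4 (2 * S + 1) × Fin 3)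
                    (TorusSite 4 (2 * S + 1) × Fin 3) ℂ)
                  - linkHop (fundamentalRep (Fin 3)) U μ
                  - (linkHop (fundamentalRep (Fin 3)) U μ)ᴴ)) *ᵥ v).re
                  ≤ E' * ∑ i, ‖v i‖ ^ 2).card : ℝ) *
              ∏ f : Fin Nf, ‖fermionDet (wilsonDirac (fundamentalRep (Fin 3)) U (b f) 1)‖)
          (wilsonMeasure (d := 4) (L := 2 * S + 1) (fundamentalRep (Fin 3)) β) ∧
        (∫ U, (((box 4 S).filter fun c : Site 4 =>
              ∃ v : TorusSite 4 (2 * S + 1) × Fin 3 → ℂ, v ≠ 0 ∧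
                (∀ p : TorusSite 4 (2 * S + 1) × Fin 3, p.1 ∉ torusBox (2 * S + 1) c R → v p = 0) ∧
                (star v ⬝ᵥ (∑ μ : Fin 4, ((2 : ℂ) • (1 : Matrix (TorusSite 4 (2 * S + 1) × Fin 3)
                    (TorusSite 4 (2 * S + 1) × Fin 3) ℂ)
                  - linkHop (fundamentalRep (Fin 3)) U μ
                  - (linkHop (fundamentalRep (Fin 3)) U μ)ᴴ)) *ᵥ v).re
                  ≤ E' * ∑ i, ‖v i‖ ^ 2).card : ℝ) *
              ∏ f : Fin Nf, ‖fermionDet (wilsonDirac (fundamentalRep (Fin 3)) U (b f) 1)‖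
            ∂(wilsonMeasure (d := 4) (L := 2 * S + 1) (fundamentalRep (Fin 3)) β)) /
          (∫ U, ∏ f : Fin Nf, ‖fermionDet (wilsonDirac (fundamentalRep (Fin 3)) U (b f) 1)‖
            ∂(wilsonMeasure (d := 4) (L := 2 * S + 1) (fundamentalRep (Fin 3)) β))
          ≤ Real.exp (-(A * β)) * (2 * S + 1 : ℝ) ^ 4 := by
  intro Nf A hA
  obtain ⟨β₀, hβ₀⟩ := hLD Nf A hA
  refine ⟨max β₀ 1, fun β hβ S R hRS hRβ E' hE' b hb => ⟨stub_coldBoxIntegrable Nf S R E' β b, ?_⟩⟩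
  have hβ1 : 1 ≤ β := le_trans (le_max_right _ _) hβ
  have hβpos : 0 < β := by linarith
  by_cases hreg : 4 * β ≤ (2 * R + 1 : ℝ) ^ 2
  · -- the large-deviation regime: volume × one-box probability
    have h1 := hβ₀ β (le_trans (le_max_left _ _) hβ) S R hRS hRβ hreg E' hE' b hb
    rw [stub_coldBoxTranslation Nf S R E' β b, mul_div_assoc]
    calc (2 * (S : ℝ) + 1) ^ 4 * _ ≤ (2 * (S : ℝ) + 1) ^ 4 * Real.exp (-(A * β)) :=
          mul_le_mul_of_nonneg_left h1 (by positivity)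
      _ = Real.exp (-(A * β)) * (2 * S + 1 : ℝ) ^ 4 := mul_comm _ _
  · -- below the Kato scale: no cold box at all
    push Not at hreg
    have hE'lt : E' < 4 / (2 * R + 1 : ℝ) ^ 2 := by
      refine lt_of_le_of_lt hE' ?_
      rw [lt_div_iff₀ (by positivity), one_div, inv_mul_lt_iff₀ hβpos]
      linarith
    have hempty := fun U : GaugeConfig 4 (2 * S + 1) SU3 => coldBox_filter_eq_empty S R hRS U E' hE'lt
    simp only [hempty, Finset.card_empty, Nat.cast_zero, zero_mul, integral_zero, zero_div]
    positivity

end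

end Summit.QuantumFields.QCD.Cruxes.TipPricing.CovariantLaplacianFloor
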